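import Summits.ValiantsHypothesis.ValiantsHypothesis.Theorems.AnyonJetsJetConstantElimPaddingPlumbing
import Summits.ValiantsHypothesis.ValiantsHypothesis.Theorems.AnyonJetsJetConstantElimSignSimulation
import HarnessLib

/-!
# AnyonJets — crux `JetConstantElim` (stmt-ValiantsHypothesis-16737), stub `stub_integralMultiple`:
# padding homogenisation of a constant-free circuit; denominators are free

Route-independent (no `Theses` import, no definitions, no `sorry`). For the OPEN stub
`stub_integralMultiple` ("a `ℚ̄`-circuit for `J_(n,k)` yields an integer circuit of polynomial
height for some multiple `M · J_(n,k)`") the multiplier `M` carries NO bound, and this file proves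
that DENOMINATORS of rational constants are indeed free:

* `pad_operand`, `pad_main`, `exists_padded_circuit` — **padding homogenisation**: a fan-in-two
  sign-constant circuit `Γ` over `ℤ` of size `S` in variables `ι`, with a weight `w ≤ 1`, is
  re-computed gate by gate "at exponent `2^(j+1)`" in a fan-in-two sign-constant circuit `Γ'`
  over `Option ι` (`none` = the padding variable `z`) of size `≤ 2 (S+2)²`, so that
  `κ_w(Γ'.eval) = z^(2^S) · Γ.eval` for the substitution `κ_w : X (some i) ↦ X (some i) · z^(w i)`,
  `z ↦ z` (uniform exponent schedule + binary lifting of `…PaddingPlumbing`).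
* `constantFreeComplexity_multiple_le_of_rat_circuit` — **clearing denominators into the
  multiplier**: if a fan-in-two `ℚ`-circuit `Q` of size `s` computes `f ∈ ℤ[x]` and
  `N · slotConst Q v = p_v ∈ ℤ` for every slot `v` of Bürgisser's integer skeleton of `Q` (tree
  `skeleton`, `aeval_slotSubst_skeleton`: size `3s`, `4s + 1` slots), then
  `τ(N^(2^(3s)) · f) ≤ 2 (3s+2)² + Σ_v τ(p_v) + τ(N)`: pad the skeleton with weight `0` on the
  variables of `f` and `1` on the slots and substitute `Y_v ↦ p_v`, `z ↦ N`; under `Y_v ↦ p_v / N`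
  the identity `κ(H) = z^(2^(3s)) · F(X, Y)` becomes `H(X, p, N) = N^(2^(3s)) · f` (checked in
  `ℚ[x]`, `map_injective`).

The bounded-height packaging in the shape of the stub is
`AnyonJetsJetConstantElimIntegralMultipleDenominators.lean`. Honest framing: the stub's content
(degree AND height of the field of definition of near-optimal circuits) is untouched; the crux
stays open; VP ≠ VNP is NOT proved here.

References: V. Strassen, *Vermeidung von Divisionen*, Crelle 264 (1973); P. Bürgisser,
*Completeness and Reduction in Algebraic Complexity Theory* (2000), §2.1, §4.1; P. Bürgisser,
*Cook's versus Valiant's hypothesis*, TCS 235 (2000), §5 (the integer skeleton).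
-/

noncomputable section

-- single-conjunct layout: Sub = Summit, duplicated namespace component intended
set_option linter.dupNamespace false

namespace Summit.ValiantsHypothesis.ValiantsHypothesis.Theorems.AnyonJets.JetConstantElim

open MvPolynomial Literature.Computability.AlgebraicComplexity
open Literature.Computability.AlgebraicComplexity.ArithCircuit

/-! ### Padding homogenisation, gate by gate -/

section Padding

variable {ι : Type*}

/-- An operand of `Γ` read at stage `j` (against the first `j` gate values `vals`) is made
available at exponent `2^j`: variables and sign constants are leaves of exponent `w i ≤ 1`
resp. `0`, a backward gate reference `i < j` is available at exponent `2^(i+1)` by the invariant,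
a junk reference has value `0`; then binary lifting. [folklore] -/
theorem pad_operand (w : ι → ℕ) (hw : ∀ i, w i ≤ 1) {S j : ℕ} (hj : j ≤ S)
    (vals : List (MvPolynomial ι ℤ)) (hvals : vals.length = j)
    {gs : List (Gate ℤ (Option ι))} (hg : ∀ g ∈ gs, g.fanIn ≤ 2 ∧ g.HasSignConstants)
    (hZ : ∀ t ≤ S, ∃ u : Operand ℤ (Option ι), u.RefsBelow gs.length ∧ u.HasSignConstants ∧
      u.eval (gateValues gs) = X none ^ 2 ^ t)
    (hInv : ∀ i < j, ∃ H : MvPolynomial (Option ι) ℤ,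
      (∃ u : Operand ℤ (Option ι), u.RefsBelow gs.length ∧ u.HasSignConstants ∧
        u.eval (gateValues gs) = H) ∧
      aeval (fun o : Option ι => Option.elim o (X none) (fun i => X (some i) * X none ^ w i)) H =
        X none ^ 2 ^ (i + 1) * rename some (vals.getD i 0))
    (u : Operand ℤ ι) (hu : u.HasSignConstants) :
    ∃ gs' : List (Gate ℤ (Option ι)), gs <+: gs' ∧
      (∀ g ∈ gs', g.fanIn ≤ 2 ∧ g.HasSignConstants) ∧ gs'.length ≤ gs.length + (S + 1) ∧
      ∃ H : MvPolynomial (Option ι) ℤ,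
        (∃ u : Operand ℤ (Option ι), u.RefsBelow gs'.length ∧ u.HasSignConstants ∧
          u.eval (gateValues gs') = H) ∧
        aeval (fun o : Option ι => Option.elim o (X none) (fun i => X (some i) * X none ^ w i)) H =
          X none ^ 2 ^ j * rename some (u.eval vals) := by
  have h2j : 2 ^ j ≤ 2 ^ S := Nat.pow_le_pow_right (by norm_num) hj
  have h2S : 2 ^ S < 2 ^ (S + 1) := Nat.pow_lt_pow_right (by norm_num) (by omega)
  cases u with
  | var i =>
    -- leaf of exponent `w i`
    have h0 : aeval (fun o : Option ι => Option.elim o (X none) (fun i => X (some i) * X none ^ w i))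
        (X (some i) : MvPolynomial (Option ι) ℤ) =
          X none ^ w i * rename some (X i : MvPolynomial ι ℤ) := by
      rw [aeval_X, rename_X]
      simp only [Option.elim]
      ring
    have hwi : w i ≤ 2 ^ j := (hw i).trans Nat.one_le_two_pow
    obtain ⟨gs', hpre, hg', hlen, H, hH, hκ⟩ := pad_lift w S (2 ^ j - w i)
      (lt_of_le_of_lt (Nat.sub_le _ _) (lt_of_le_of_lt h2j h2S)) gs hg hZ
      (X (some i)) (rename some (X i : MvPolynomial ι ℤ)) (w i) (sc_avail_X gs (some i)) h0
    refine ⟨gs', hpre, hg', hlen, H, hH, ?_⟩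
    rw [hκ, Nat.add_sub_cancel' hwi]
    rfl
  | const c =>
    have h0 : aeval (fun o : Option ι => Option.elim o (X none) (fun i => X (some i) * X none ^ w i))
        (C c : MvPolynomial (Option ι) ℤ) = X none ^ 0 * rename some (C c : MvPolynomial ι ℤ) := by
      rw [aeval_C, rename_C, pow_zero, one_mul, MvPolynomial.algebraMap_eq]
    obtain ⟨gs', hpre, hg', hlen, H, hH, hκ⟩ := pad_lift w S (2 ^ j) (lt_of_le_of_lt h2j h2S) gs hg hZ
      (C c) (rename some (C c : MvPolynomial ι ℤ)) 0 (sc_avail_C gs hu) h0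
    refine ⟨gs', hpre, hg', hlen, H, hH, ?_⟩
    rw [hκ, Nat.zero_add]
    rfl
  | gate i =>
    rcases Nat.lt_or_ge i j with hij | hji
    · -- backward reference: available at exponent `2^(i+1)`, lift by `2^j - 2^(i+1)`
      obtain ⟨H₀, hH₀, hκ₀⟩ := hInv i hij
      have hle : 2 ^ (i + 1) ≤ 2 ^ j := Nat.pow_le_pow_right (by norm_num) hij
      obtain ⟨gs', hpre, hg', hlen, H, hH, hκ⟩ := pad_lift w S (2 ^ j - 2 ^ (i + 1))
        (lt_of_le_of_lt (Nat.sub_le _ _) (lt_of_le_of_lt h2j h2S))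
        gs hg hZ H₀ (rename some (vals.getD i 0)) (2 ^ (i + 1)) hH₀ hκ₀
      refine ⟨gs', hpre, hg', hlen, H, hH, ?_⟩
      rw [hκ, Nat.add_sub_cancel' hle]
      rfl
    · -- junk reference: value `0`
      have hval : (Operand.gate i : Operand ℤ ι).eval vals = 0 := by
        simp [Operand.eval, List.getD_eq_getElem?_getD, List.getElem?_eq_none (hvals ▸ hji)]
      refine ⟨gs, List.prefix_rfl, hg, by omega, C 0, sc_avail_C gs isSignConstant_zero, ?_⟩
      rw [hval]
      simp

/-- **The padding pass.** For every `j ≤ S = size Γ` there is a fan-in-two sign-constant gate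
list of length `≤ S + j (2S + 4)` in which all `z^(2^t)`, `t ≤ S`, are available and, for each
`i < j`, some `H_i` with `κ_w(H_i) = z^(2^(i+1)) · (value of gate i of Γ)`. [folklore] -/
theorem pad_main (w : ι → ℕ) (hw : ∀ i, w i ≤ 1) (Γ : ArithCircuit ℤ ι) (h2 : Γ.IsFanInTwo)
    (hs : Γ.HasSignConstants) :
    ∀ j ≤ Γ.size, ∃ gs : List (Gate ℤ (Option ι)),
      (∀ g ∈ gs, g.fanIn ≤ 2 ∧ g.HasSignConstants) ∧
      gs.length ≤ Γ.size + j * (2 * Γ.size + 4) ∧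
      (∀ t ≤ Γ.size, ∃ u : Operand ℤ (Option ι), u.RefsBelow gs.length ∧ u.HasSignConstants ∧
        u.eval (gateValues gs) = X none ^ 2 ^ t) ∧
      ∀ i < j, ∃ H : MvPolynomial (Option ι) ℤ,
        (∃ u : Operand ℤ (Option ι), u.RefsBelow gs.length ∧ u.HasSignConstants ∧
          u.eval (gateValues gs) = H) ∧
        aeval (fun o : Option ι => Option.elim o (X none) (fun i => X (some i) * X none ^ w i)) H =
          X none ^ 2 ^ (i + 1) * rename some ((gateValues (Γ.gates.take j)).getD i 0) := by
  -- abbreviation-free bookkeeping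
  have hdouble : ∀ j : ℕ, (2 : ℕ) ^ j + 2 ^ j = 2 ^ (j + 1) := fun j => by
    rw [← two_mul, ← pow_succ']
  intro j
  induction j with
  | zero =>
    intro _
    obtain ⟨gs, -, hg, hlen, hZ⟩ := pad_powers ([] : List (Gate ℤ (Option ι))) (by simp) Γ.size
    exact ⟨gs, hg, by simpa using hlen, hZ, fun i hi => absurd hi (Nat.not_lt_zero _)⟩
  | succ j ih =>
    intro hj1
    obtain ⟨gs, hg, hlen, hZ, hInv⟩ := ih (Nat.le_of_succ_le hj1)
    have hjlt : j < Γ.gates.length := hj1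
    set S := Γ.size with hS
    have hvals : (gateValues (Γ.gates.take j)).length = j := by
      rw [gateValues_length, List.length_take, Nat.min_eq_left hjlt.le]
    have hgmem : Γ.gates[j] ∈ Γ.gates := List.getElem_mem hjlt
    have hg2 : (Γ.gates[j]).fanIn ≤ 2 := h2 _ hgmem
    have hgs : (Γ.gates[j]).HasSignConstants := hs.1 _ hgmem
    -- the new value list
    have htake : gateValues (Γ.gates.take (j + 1)) =
        gateValues (Γ.gates.take j) ++ [(Γ.gates[j]).eval (gateValues (Γ.gates.take j))] := by
      rw [List.take_succ_eq_append_getElem hjlt]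
      exact gateValues_append_singleton _ _
    generalize hg_def : Γ.gates[j] = g at hgmem hg2 hgs htake
    generalize hvals_def : gateValues (Γ.gates.take j) = vals at hvals hInv htake
    -- it suffices to make `g.eval vals` available at exponent `2^(j+1)` in an extension of `gs`
    suffices hnew : ∃ gs' : List (Gate ℤ (Option ι)), gs <+: gs' ∧
        (∀ g ∈ gs', g.fanIn ≤ 2 ∧ g.HasSignConstants) ∧ gs'.length ≤ gs.length + (2 * S + 4) ∧
        ∃ H : MvPolynomial (Option ι) ℤ,
          (∃ u : Operand ℤ (Option ι), u.RefsBelow gs'.length ∧ u.HasSignConstants ∧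
            u.eval (gateValues gs') = H) ∧
          aeval (fun o : Option ι => Option.elim o (X none) (fun i => X (some i) * X none ^ w i)) H =
            X none ^ 2 ^ (j + 1) * rename some (g.eval vals) by
      obtain ⟨gs', hpre, hg', hlen', H, hH, hκ⟩ := hnew
      refine ⟨gs', hg', ?_, fun t ht => sc_avail_mono hpre (hZ t ht), fun i hi => ?_⟩
      · have hmul : (j + 1) * (2 * S + 4) = j * (2 * S + 4) + (2 * S + 4) := by ring
        rw [hmul]
        omega
      · rw [htake]
        rcases Nat.lt_or_ge i j with hij | hji
        · obtain ⟨H', hH', hκ'⟩ := hInv i hij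
          refine ⟨H', sc_avail_mono hpre hH', ?_⟩
          rw [hκ', List.getD_append _ _ _ _ (by rw [hvals]; exact hij)]
        · obtain rfl : i = j := by omega
          refine ⟨H, hH, ?_⟩
          rw [hκ, List.getD_append_right _ _ _ _ (by rw [hvals])]
          simp [hvals]
    -- operands at exponent `2^j`, one after the other
    have hop : ∀ (gs₀ : List (Gate ℤ (Option ι))), gs <+: gs₀ →
        (∀ g ∈ gs₀, g.fanIn ≤ 2 ∧ g.HasSignConstants) →
        ∀ (u : Operand ℤ ι), u.HasSignConstants →
        ∃ gs' : List (Gate ℤ (Option ι)), gs₀ <+: gs' ∧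
          (∀ g ∈ gs', g.fanIn ≤ 2 ∧ g.HasSignConstants) ∧ gs'.length ≤ gs₀.length + (S + 1) ∧
          ∃ H : MvPolynomial (Option ι) ℤ,
            (∃ u : Operand ℤ (Option ι), u.RefsBelow gs'.length ∧ u.HasSignConstants ∧
              u.eval (gateValues gs') = H) ∧
            aeval (fun o : Option ι => Option.elim o (X none) (fun i => X (some i) * X none ^ w i))
              H = X none ^ 2 ^ j * rename some (u.eval vals) := by
      intro gs₀ hpre₀ hg₀ u hu
      exact pad_operand w hw (Nat.le_of_succ_le hj1) vals hvals hg₀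
        (fun t ht => sc_avail_mono hpre₀ (hZ t ht))
        (fun i hi => by
          obtain ⟨H, hH, hκ⟩ := hInv i hi
          exact ⟨H, sc_avail_mono hpre₀ hH, hκ⟩) u hu
    have hZj : ∀ (gs₀ : List (Gate ℤ (Option ι))), gs <+: gs₀ →
        ∃ u : Operand ℤ (Option ι), u.RefsBelow gs₀.length ∧ u.HasSignConstants ∧
          u.eval (gateValues gs₀) = X none ^ 2 ^ j :=
      fun gs₀ hpre₀ => sc_avail_mono hpre₀ (hZ j (Nat.le_of_succ_le hj1))
    -- case analysis on the old gate
    cases g with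
    | sum args =>
      rcases args with _ | ⟨⟨a, u⟩, _ | ⟨⟨b, v⟩, _ | ⟨c, rest⟩⟩⟩
      · -- `Σ ∅ = 0`
        refine ⟨gs, List.prefix_rfl, hg, by omega, C 0, sc_avail_C gs isSignConstant_zero, ?_⟩
        simp [Gate.eval]
      · -- `a • u`
        have hau : IsSignConstant a ∧ u.HasSignConstants := hgs (a, u) (by simp)
        obtain ⟨gs₁, hpre₁, hg₁, hlen₁, Hu, hHu, hκu⟩ := hop gs List.prefix_rfl hg u hau.2
        obtain ⟨gs₂, hpre₂, hg₂, hlen₂, hsum⟩ :=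
          sc_extend_sum hg₁ hau.1 isSignConstant_zero hHu (sc_avail_C gs₁ isSignConstant_zero)
        have halg : aeval (fun o : Option ι => Option.elim o (X none) (fun i => X (some i) * X none ^ w i))
            (a • Hu + (0 : ℤ) • (C 0 : MvPolynomial (Option ι) ℤ)) =
            X none ^ 2 ^ j * rename some (a • u.eval vals) := by
          rw [zero_smul, add_zero, map_smul, hκu, map_smul, mul_smul_comm]
        obtain ⟨gs₃, hpre₃, hg₃, hlen₃, H, hH, hκ⟩ := pad_mulZ w hg₂ (hZj gs₂ (hpre₁.trans hpre₂))
          hsum halg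
        refine ⟨gs₃, hpre₁.trans (hpre₂.trans hpre₃), hg₃, by omega, H, hH, ?_⟩
        rw [hκ, hdouble]
        simp [Gate.eval]
      · -- `a • u + b • v`
        have hau : IsSignConstant a ∧ u.HasSignConstants := hgs (a, u) (by simp)
        have hbv : IsSignConstant b ∧ v.HasSignConstants := hgs (b, v) (by simp)
        obtain ⟨gs₁, hpre₁, hg₁, hlen₁, Hu, hHu, hκu⟩ := hop gs List.prefix_rfl hg u hau.2
        obtain ⟨gs₂, hpre₂, hg₂, hlen₂, Hv, hHv, hκv⟩ := hop gs₁ hpre₁ hg₁ v hbv.2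
        obtain ⟨gs₃, hpre₃, hg₃, hlen₃, hsum⟩ :=
          sc_extend_sum hg₂ hau.1 hbv.1 (sc_avail_mono hpre₂ hHu) hHv
        have halg : aeval (fun o : Option ι => Option.elim o (X none) (fun i => X (some i) * X none ^ w i))
            (a • Hu + b • Hv) = X none ^ 2 ^ j * rename some (a • u.eval vals + b • v.eval vals) := by
          rw [map_add, map_smul, map_smul, hκu, hκv, map_add, map_smul, map_smul, ← mul_smul_comm,
            ← mul_smul_comm, ← mul_add]
        obtain ⟨gs₄, hpre₄, hg₄, hlen₄, H, hH, hκ⟩ := pad_mulZ w hg₃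
          (hZj gs₃ (hpre₁.trans (hpre₂.trans hpre₃))) hsum halg
        refine ⟨gs₄, hpre₁.trans (hpre₂.trans (hpre₃.trans hpre₄)), hg₄, by omega, H, hH, ?_⟩
        rw [hκ, hdouble]
        simp [Gate.eval]
      · -- fan-in `≥ 3`: excluded
        exfalso
        simp [Gate.fanIn, Gate.args] at hg2
    | prod args =>
      rcases args with _ | ⟨u, _ | ⟨v, _ | ⟨c, rest⟩⟩⟩
      · -- `Π ∅ = 1`: the power `z^(2^(j+1))` itself
        obtain ⟨uZ, huZ, hsZ, heZ⟩ := hZ (j + 1) hj1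
        refine ⟨gs, List.prefix_rfl, hg, by omega, X none ^ 2 ^ (j + 1), ⟨uZ, huZ, hsZ, heZ⟩, ?_⟩
        rw [map_pow, aeval_X]
        simp [Gate.eval, Option.elim]
      · -- `Π [u] = u`
        have hu : u.HasSignConstants := hgs u (by simp)
        obtain ⟨gs₁, hpre₁, hg₁, hlen₁, Hu, hHu, hκu⟩ := hop gs List.prefix_rfl hg u hu
        obtain ⟨gs₂, hpre₂, hg₂, hlen₂, H, hH, hκ⟩ := pad_mulZ w hg₁ (hZj gs₁ hpre₁) hHu hκu
        refine ⟨gs₂, hpre₁.trans hpre₂, hg₂, by omega, H, hH, ?_⟩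
        rw [hκ, hdouble]
        simp [Gate.eval]
      · -- `u * v`
        have hu : u.HasSignConstants := hgs u (by simp)
        have hv : v.HasSignConstants := hgs v (by simp)
        obtain ⟨gs₁, hpre₁, hg₁, hlen₁, Hu, hHu, hκu⟩ := hop gs List.prefix_rfl hg u hu
        obtain ⟨gs₂, hpre₂, hg₂, hlen₂, Hv, hHv, hκv⟩ := hop gs₁ hpre₁ hg₁ v hv
        obtain ⟨gs₃, hpre₃, hg₃, hlen₃, hprod⟩ := sc_extend_prod hg₂ (sc_avail_mono hpre₂ hHu) hHv
        refine ⟨gs₃, hpre₁.trans (hpre₂.trans hpre₃), hg₃, by omega, Hu * Hv, hprod, ?_⟩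
        rw [map_mul, hκu, hκv, ← hdouble]
        simp [Gate.eval]
        ring
      · exfalso
        simp [Gate.fanIn, Gate.args] at hg2


/-- **Padding homogenisation of a constant-free circuit.** For a fan-in-two sign-constant
circuit `Γ` over `ℤ` of size `S` and a weight `w ≤ 1` on its variables there is a fan-in-two
sign-constant circuit `Γ'` over `Option ι` of size `≤ 2 (S+2)²` with
`κ_w(Γ'.eval) = z^(2^S) · Γ.eval`, `κ_w : X (some i) ↦ X (some i) · z^(w i)`, `z = X none ↦ z`.
[folklore; cf. Strassen 1973 (Vermeidung von Divisionen), Bürgisser 2000 §2.1] -/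
theorem exists_padded_circuit (w : ι → ℕ) (hw : ∀ i, w i ≤ 1) (Γ : ArithCircuit ℤ ι)
    (h2 : Γ.IsFanInTwo) (hs : Γ.HasSignConstants) :
    ∃ Γ' : ArithCircuit ℤ (Option ι), Γ'.IsFanInTwo ∧ Γ'.HasSignConstants ∧
      Γ'.size ≤ 2 * (Γ.size + 2) ^ 2 ∧
      aeval (fun o : Option ι => Option.elim o (X none) (fun i => X (some i) * X none ^ w i)) Γ'.eval =
        X none ^ 2 ^ Γ.size * rename some Γ.eval := by
  obtain ⟨gs, hg, hlen, hZ, hInv⟩ := pad_main w hw Γ h2 hs Γ.size le_rfl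
  rw [show Γ.gates.take Γ.size = Γ.gates from List.take_length] at hInv
  obtain ⟨gs', hpre, hg', hlen', H, ⟨u, hu, hus, huH⟩, hκ⟩ :=
    pad_operand w hw le_rfl (gateValues Γ.gates) (gateValues_length _) hg hZ hInv Γ.output hs.2
  refine ⟨⟨gs', u⟩, fun g hg'' => (hg' g hg'').1, ⟨fun g hg'' => (hg' g hg'').2, hus⟩, ?_, ?_⟩
  · change gs'.length ≤ 2 * (Γ.size + 2) ^ 2
    have hsq : Γ.size * (2 * Γ.size + 4) + 2 * Γ.size + 1 ≤ 2 * (Γ.size + 2) ^ 2 := by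
      ring_nf; omega
    have hsz : Γ.size = Γ.gates.length := rfl
    omega
  · change aeval _ (u.eval (gateValues gs')) = _
    rw [huH, hκ]
    rfl

end Padding
/-! ### Denominators are free: an integer multiple of `f` from a `ℚ`-circuit for `f` -/

section Denominators

variable {σ : Type*}

/-- **Clearing denominators into a multiplier, constant-freely.** If a fan-in-two `ℚ`-circuit
`Q` of size `s` computes the integer polynomial `f`, and `N` is a common denominator of its
constants (`N · slotConst Q v = p_v ∈ ℤ` for every slot `v` of Bürgisser's integer skeleton), then
`τ(N^(2^(3s)) · f) ≤ 2 (3s+2)² + Σ_v τ(p_v) + τ(N)`: pad the skeleton (`exists_padded_circuit`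
with weight `0` on the variables of `f`, `1` on the slots) and substitute `X_x ↦ X_x`,
`Y_v ↦ p_v`, `z ↦ N`; the identity `κ(H) = z^(2^(3s)) · F(X, Y)` specialises, under
`Y_v ↦ p_v / N`, to `H(X, p, N) = N^(2^(3s)) · f`. [folklore; Bürgisser 2000 §4.1, §1.4] -/
theorem constantFreeComplexity_multiple_le_of_rat_circuit (f : MvPolynomial σ ℤ)
    (Q : ArithCircuit ℚ σ) (h2 : Q.IsFanInTwo)
    (hc : Q.Computes (MvPolynomial.map (Int.castRingHom ℚ) f)) (N : ℕ)
    (p : Fin (4 * Q.size + 1) → ℤ) (hp : ∀ v : Fin (4 * Q.size + 1), (N : ℚ) * slotConst Q v = p v) :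
    constantFreeComplexity (((N : ℤ) ^ 2 ^ (3 * Q.size)) • f) ≤
      2 * (3 * Q.size + 2) ^ 2 + (∑ v, constantFreeComplexity (C (p v) : MvPolynomial σ ℤ)) +
        constantFreeComplexity (C (N : ℤ) : MvPolynomial σ ℤ) := by
  classical
  -- the integer skeleton and its padding
  set Γ : ArithCircuit ℤ (σ ⊕ Fin (4 * Q.size + 1)) := skeleton Q with hΓ
  have hΓ2 : Γ.IsFanInTwo := isFanInTwo_skeleton Q
  have hΓs : Γ.HasSignConstants := hasSignConstants_skeleton Q
  have hΓsize : Γ.size = 3 * Q.size := size_skeleton Q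
  have hΓeval : aeval (slotSubst Q) Γ.eval = MvPolynomial.map (Int.castRingHom ℚ) f :=
    (aeval_slotSubst_skeleton Q h2).trans hc
  set w : σ ⊕ Fin (4 * Q.size + 1) → ℕ := Sum.elim (fun _ => 0) (fun _ => 1) with hw_def
  have hw : ∀ i, w i ≤ 1 := by rintro (i | i) <;> simp [hw_def]
  obtain ⟨Γ', hΓ'2, hΓ's, hΓ'size, hκ⟩ := exists_padded_circuit w hw Γ hΓ2 hΓs
  rw [hΓsize] at hΓ'size hκ
  -- the integer substitution
  set g : Fin (4 * Q.size + 1 + 1) → MvPolynomial σ ℤ := Fin.snoc (fun v => C (p v)) (C (N : ℤ))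
    with hg_def
  set e : Option (σ ⊕ Fin (4 * Q.size + 1)) → σ ⊕ Fin (4 * Q.size + 1 + 1) :=
    fun o => Option.elim o (Sum.inr (Fin.last _)) (Sum.map id Fin.castSucc) with he_def
  have hev : (Sum.elim X g : σ ⊕ Fin (4 * Q.size + 1 + 1) → MvPolynomial σ ℤ) ∘ e =
      fun o : Option (σ ⊕ Fin (4 * Q.size + 1)) =>
        Option.elim o (C (N : ℤ)) (Sum.elim X (fun v => C (p v))) := by
    funext o
    rcases o with _ | (x | v) <;> simp [he_def, hg_def]
  -- the key identity, checked in `ℚ[x]`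
  have hkey : aeval (Sum.elim X g) (rename e Γ'.eval) = ((N : ℤ) ^ 2 ^ (3 * Q.size)) • f := by
    rw [aeval_rename, hev]
    apply MvPolynomial.map_injective (Int.castRingHom ℚ) Int.cast_injective
    -- both substitutions agree after `κ`, slot by slot (`N · slotConst v = p v`)
    set evQ : Option (σ ⊕ Fin (4 * Q.size + 1)) → MvPolynomial σ ℚ :=
      fun o => Option.elim o (C (N : ℚ)) (Sum.elim X (fun v => C (slotConst Q v))) with hevQ
    have hF : ∀ o : Option (σ ⊕ Fin (4 * Q.size + 1)),
        MvPolynomial.map (Int.castRingHom ℚ)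
            (Option.elim o (C (N : ℤ)) (Sum.elim X (fun v => C (p v))) : MvPolynomial σ ℤ) =
          bind₁ evQ (MvPolynomial.map (Int.castRingHom ℚ)
            (Option.elim o (X none) (fun i => X (some i) * X none ^ w i) :
              MvPolynomial (Option (σ ⊕ Fin (4 * Q.size + 1))) ℤ)) := by
      intro o
      rcases o with _ | (x | v)
      · simp [hevQ]
      · simp [hevQ, hw_def]
      · have hC : (C ((p v : ℤ) : ℚ) : MvPolynomial σ ℚ) = C (slotConst Q v) * C (N : ℚ) := by
          rw [← map_mul, mul_comm, hp v]
        simpa [hevQ, hw_def] using hC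
    have hL : MvPolynomial.map (Int.castRingHom ℚ)
        (aeval (fun o : Option (σ ⊕ Fin (4 * Q.size + 1)) =>
          Option.elim o (C (N : ℤ)) (Sum.elim X (fun v => C (p v)))) Γ'.eval) =
        bind₁ evQ (MvPolynomial.map (Int.castRingHom ℚ)
          (aeval (fun o : Option (σ ⊕ Fin (4 * Q.size + 1)) => Option.elim o (X none)
            (fun i => X (some i) * X none ^ w i)) Γ'.eval)) := by
      rw [aeval_eq_bind₁, aeval_eq_bind₁, map_bind₁, map_bind₁, bind₁_bind₁]
      exact congrArg (fun F => bind₁ F (MvPolynomial.map (Int.castRingHom ℚ) Γ'.eval)) (funext hF)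
    have hslot : (evQ ∘ some) = slotSubst Q := by
      funext i; rcases i with x | v <;> simp [hevQ, slotSubst]
    have hmapalg : MvPolynomial.map (Int.castRingHom ℚ) Γ.eval =
        MvPolynomial.map (algebraMap ℤ ℚ) Γ.eval := rfl
    rw [hL, hκ, map_mul, map_pow, map_X, map_rename, map_mul, map_pow, bind₁_X_right, bind₁_rename,
      hslot, ← aeval_eq_bind₁, hmapalg, aeval_map_algebraMap, hΓeval, MvPolynomial.smul_eq_C_mul,
      map_mul, map_C]
    simp [hevQ]
  -- cost
  calc constantFreeComplexity (((N : ℤ) ^ 2 ^ (3 * Q.size)) • f)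
      = constantFreeComplexity (aeval (Sum.elim X g) (rename e Γ'.eval)) := by rw [hkey]
    _ ≤ constantFreeComplexity (rename e Γ'.eval) + ∑ t, constantFreeComplexity (g t) :=
        constantFreeComplexity_aeval_sumElim_le _ _
    _ ≤ Γ'.size + ((∑ v, constantFreeComplexity (C (p v) : MvPolynomial σ ℤ)) +
          constantFreeComplexity (C (N : ℤ) : MvPolynomial σ ℤ)) := by
        apply add_le_add
        · exact (constantFreeComplexity_rename_le e _).trans
            (constantFreeComplexity_le_size hΓ'2 hΓ's rfl)
        · rw [Fin.sum_univ_castSucc]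
          simp [hg_def]
    _ ≤ _ := by omega

end Denominators

end Summit.ValiantsHypothesis.ValiantsHypothesis.Theorems.AnyonJets.JetConstantElim

end
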